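import Summits.CriticalPhenomena.PercolationContinuityZ3.Theorems.Transplant.FKConnectivityAllQAntipodalRootFormAttachP

/-!
# Connectivity correlation inequalities for `φ_{w,q}`, every `q > 0` — ROOT-FORM CALCULUS, file 61v: GENERAL PARALLEL ATTACHMENT, the other
# four facts (`parE`, deleted / contracted / free-nested AND) and the regrouping lemma

Support file (`--supports stmt-CriticalPhenomena-4575`), FK sub-lane `prim-bschramm-fk-2` (gen 29); builds on p205010 (kernel theorem,
internal audit signed; external expert review pending).  No definitions, no named facts, no sorries; standard axioms.  Memo
FROM-fk-2-g28-ROOT-FORM.md §3 (functional form).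

`regroup`: the kind-`(1,0)`/`(0,1)` part of any bilinear expression in the weights, summed over the box configurations, regrouped by level into
the aggregate weights `aggW`.  `attP_andCon_nonneg` (every kind is a contracted AND of `𝓔`), `attP_andDel_nonneg` (kinds `00/11` = deleted /
contracted AND of `𝓔`, the mixed kinds pair into ONE nested free AND per level), `attP_andFree_nonneg` (likewise), `attP_parE_Mt_nonneg`
(`g ∥ (A ∥ 𝓔) = A ∥ (g ∥ 𝓔)`), and the bundle `attP_facts`: the five facts of the word theorem pass from `𝓔` to `A ∥ 𝓔` for every abstract
special-free box `A` satisfying Theorem U at every exact level.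
[folklore]
-/

noncomputable section

namespace Summit.CriticalPhenomena.PercolationContinuityZ3.Theorems

namespace FK

namespace RootForm

open Finset Base

section Facts

variable {BA C : Type*} [Fintype BA] [Preorder BA] [Fintype C] [Preorder C] (A : BA → SDat) (E : Env C)

omit [Fintype BA] [Preorder BA] [Fintype C] [Preorder C] in
/-- **Contracted AND of `A ∥ 𝓔`**: every kind is the contracted AND of `𝓔` at the level `J − L − c − c̄`. [folklore] -/
theorem andCon_attP (α : BA) (γ : C) (J : ℤ) :
    (attP A E (α, γ)).andCon J = (E γ).andCon (J - (A α).L - bit (A α).c - bit (A α).cb) := by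
  have h : ∀ d : PDat, (acomb (A α) d).acon J = d.acon (J - (A α).L - bit (A α).c - bit (A α).cb) := fun d => by
    obtain ⟨L, c, cb⟩ := A α; obtain ⟨l, k1, k2⟩ := d
    refine ind_congr ?_
    cases c <;> cases cb <;> cases k1 <;> cases k2 <;> simp [acomb] <;> omega
  simp only [EDat.andCon, attP, h]

omit [Fintype BA] [Preorder BA] [Fintype C] [Preorder C] in
/-- **Deleted AND of `A ∥ 𝓔` by kind.** [folklore] -/
theorem andDel_attP (α : BA) (γ : C) (J : ℤ) :
    (attP A E (α, γ)).andDel J = kd (A α) false false * (E γ).andDel (J - (A α).L) + kd (A α) true true * (E γ).andCon (J - (A α).L)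
      + kd (A α) true false * (E γ).andE1 (J - (A α).L) + kd (A α) false true * (E γ).andE2 (J - (A α).L) := by
  have h : ∀ d : PDat, (acomb (A α) d).adel J = kd (A α) false false * d.adel (J - (A α).L) + kd (A α) true true * d.acon (J - (A α).L)
      + kd (A α) true false * d.a1 (J - (A α).L) + kd (A α) false true * d.a2 (J - (A α).L) := fun d => by
    obtain ⟨L, c, cb⟩ := A α; obtain ⟨l, k1, k2⟩ := d
    cases c <;> cases cb <;> cases k1 <;> cases k2 <;> simp [acomb, kd, PDat.adel, PDat.acon, PDat.a1, PDat.a2] <;>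
      first | rfl | exact ind_congr (by omega)
  simp only [EDat.andDel, EDat.andCon, EDat.andE1, EDat.andE2, attP, h]; ring

omit [Fintype BA] [Preorder BA] [Fintype C] [Preorder C] in
/-- **Free nested AND of `A ∥ 𝓔` by kind** (root in replica 1 resp. 2). [folklore] -/
theorem andE_attP (α : BA) (γ : C) (J : ℤ) :
    (attP A E (α, γ)).andE1 J = kd (A α) false false * (E γ).andE1 (J - (A α).L) + kd (A α) true true * (E γ).andCon (J - (A α).L - 1)
      + kd (A α) true false * (E γ).andE1 (J - (A α).L - 1) + kd (A α) false true * (E γ).andCon (J - (A α).L) ∧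
    (attP A E (α, γ)).andE2 J = kd (A α) false false * (E γ).andE2 (J - (A α).L) + kd (A α) true true * (E γ).andCon (J - (A α).L - 1)
      + kd (A α) true false * (E γ).andCon (J - (A α).L) + kd (A α) false true * (E γ).andE2 (J - (A α).L - 1) := by
  have h1 : ∀ d : PDat, (acomb (A α) d).a1 J = kd (A α) false false * d.a1 (J - (A α).L) + kd (A α) true true * d.acon (J - (A α).L - 1)
      + kd (A α) true false * d.a1 (J - (A α).L - 1) + kd (A α) false true * d.acon (J - (A α).L) := fun d => by
    obtain ⟨L, c, cb⟩ := A α; obtain ⟨l, k1, k2⟩ := d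
    cases c <;> cases cb <;> cases k1 <;> cases k2 <;> simp [acomb, kd, PDat.acon, PDat.a1] <;> exact ind_congr (by omega)
  have h2 : ∀ d : PDat, (acomb (A α) d).a2 J = kd (A α) false false * d.a2 (J - (A α).L) + kd (A α) true true * d.acon (J - (A α).L - 1)
      + kd (A α) true false * d.acon (J - (A α).L) + kd (A α) false true * d.a2 (J - (A α).L - 1) := fun d => by
    obtain ⟨L, c, cb⟩ := A α; obtain ⟨l, k1, k2⟩ := d
    cases c <;> cases cb <;> cases k1 <;> cases k2 <;> simp [acomb, kd, PDat.acon, PDat.a2] <;> exact ind_congr (by omega)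
  simp only [EDat.andE1, EDat.andE2, EDat.andCon, attP, h1, h2]; constructor <;> ring

end Facts

section Nonneg

variable {BA C : Type*} [Fintype BA] [Preorder BA] [Fintype C] [Preorder C] (A : BA → SDat) (E : Env C)

/-- **Fact 4 for `A ∥ 𝓔`.** [folklore] -/
theorem attP_andCon_nonneg (f4 : ∀ h : C → ℝ, Monotone h → (∀ γ, 0 ≤ h γ) → ∀ J : ℤ, 0 ≤ ∑ γ, h γ * (E γ).andCon J)
    (h : BA × C → ℝ) (mh : Monotone h) (nh : ∀ p, 0 ≤ h p) (J : ℤ) : 0 ≤ ∑ p, h p * (attP A E p).andCon J := by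
  rw [Fintype.sum_prod_type]
  refine Finset.sum_nonneg fun α _ => ?_
  simp only [andCon_attP]
  exact f4 _ (mono_right mh α) (fun γ => nh _) _

/-- **Fact 3 for `A ∥ 𝓔`.** [folklore] -/
theorem attP_andDel_nonneg
    (hU : ∀ h : BA → ℝ, Monotone h → (∀ α, 0 ≤ h α) → ∀ K : ℤ,
      0 ≤ ∑ α, h α * ((if (A α).L = K then (1 : ℝ) else 0) * (kd (A α) true false - kd (A α) false true)))
    (f3 : ∀ h : C → ℝ, Monotone h → (∀ γ, 0 ≤ h γ) → ∀ J : ℤ, 0 ≤ ∑ γ, h γ * (E γ).andDel J)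
    (f4 : ∀ h : C → ℝ, Monotone h → (∀ γ, 0 ≤ h γ) → ∀ J : ℤ, 0 ≤ ∑ γ, h γ * (E γ).andCon J)
    (f5 : ∀ h0 h1 : C → ℝ, Monotone h0 → Monotone h1 → (∀ γ, 0 ≤ h0 γ) → (∀ γ, h0 γ ≤ h1 γ) → ∀ J : ℤ,
      0 ≤ ∑ γ, (h1 γ * (E γ).andE1 J + h0 γ * (E γ).andE2 J))
    (h : BA × C → ℝ) (mh : Monotone h) (nh : ∀ p, 0 ≤ h p) (J : ℤ) : 0 ≤ ∑ p, h p * (attP A E p).andDel J := by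
  have R := regroup A h h (fun γ J => (E γ).andE1 J) (fun _ _ => 0) (fun _ _ => 0) (fun γ J => (E γ).andE2 J) J
  simp only [mul_zero, add_zero, zero_add] at R
  have hsplit : ∑ p, h p * (attP A E p).andDel J =
      ∑ α, ∑ γ, kd (A α) false false * (h (α, γ) * (E γ).andDel (J - (A α).L))
      + ∑ α, ∑ γ, kd (A α) true true * (h (α, γ) * (E γ).andCon (J - (A α).L))
      + (∑ α, ∑ γ, kd (A α) true false * (h (α, γ) * (E γ).andE1 (J - (A α).L))
        + ∑ α, ∑ γ, kd (A α) false true * (h (α, γ) * (E γ).andE2 (J - (A α).L))) := by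
    rw [Fintype.sum_prod_type]
    simp only [andDel_attP, ← Finset.sum_add_distrib]
    exact Finset.sum_congr rfl fun α _ => Finset.sum_congr rfl fun γ _ => by ring
  rw [hsplit, R]
  refine add_nonneg (add_nonneg (Finset.sum_nonneg fun α _ => ?_) (Finset.sum_nonneg fun α _ => ?_)) (Finset.sum_nonneg fun K _ => ?_)
  · rw [← Finset.mul_sum]; exact mul_nonneg (kd_nonneg _ _ _) (f3 _ (mono_right mh α) (fun γ => nh _) _)
  · rw [← Finset.mul_sum]; exact mul_nonneg (kd_nonneg _ _ _) (f4 _ (mono_right mh α) (fun γ => nh _) _)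
  · have hm := aggW_mono A hU mh nh K
    exact f5 _ _ (mono_sec hm false) (mono_sec hm true) (fun γ => aggW_nonneg A nh K _) (fun γ => sec_le hm γ) _

/-- **Fact 5 for `A ∥ 𝓔`.** [folklore] -/
theorem attP_andFree_nonneg
    (hU : ∀ h : BA → ℝ, Monotone h → (∀ α, 0 ≤ h α) → ∀ K : ℤ,
      0 ≤ ∑ α, h α * ((if (A α).L = K then (1 : ℝ) else 0) * (kd (A α) true false - kd (A α) false true)))
    (f4 : ∀ h : C → ℝ, Monotone h → (∀ γ, 0 ≤ h γ) → ∀ J : ℤ, 0 ≤ ∑ γ, h γ * (E γ).andCon J)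
    (f5 : ∀ h0 h1 : C → ℝ, Monotone h0 → Monotone h1 → (∀ γ, 0 ≤ h0 γ) → (∀ γ, h0 γ ≤ h1 γ) → ∀ J : ℤ,
      0 ≤ ∑ γ, (h1 γ * (E γ).andE1 J + h0 γ * (E γ).andE2 J))
    (h0 h1 : BA × C → ℝ) (m0 : Monotone h0) (m1 : Monotone h1) (n0 : ∀ p, 0 ≤ h0 p) (le : ∀ p, h0 p ≤ h1 p) (J : ℤ) :
    0 ≤ ∑ p, (h1 p * (attP A E p).andE1 J + h0 p * (attP A E p).andE2 J) := by
  have n1 : ∀ p, 0 ≤ h1 p := fun p => (n0 p).trans (le p)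
  have R := regroup A h0 h1 (fun γ J => (E γ).andE1 (J - 1)) (fun _ _ => 0) (fun _ _ => 0) (fun γ J => (E γ).andE2 (J - 1)) J
  simp only [mul_zero, add_zero, zero_add] at R
  have hsplit : ∑ p, (h1 p * (attP A E p).andE1 J + h0 p * (attP A E p).andE2 J) =
      ∑ α, ∑ γ, kd (A α) false false * (h1 (α, γ) * (E γ).andE1 (J - (A α).L) + h0 (α, γ) * (E γ).andE2 (J - (A α).L))
      + ∑ α, ∑ γ, kd (A α) true true * ((h1 (α, γ) + h0 (α, γ)) * (E γ).andCon (J - (A α).L - 1))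
      + ∑ α, ∑ γ, (kd (A α) true false * h0 (α, γ) + kd (A α) false true * h1 (α, γ)) * (E γ).andCon (J - (A α).L)
      + (∑ α, ∑ γ, kd (A α) true false * (h1 (α, γ) * (E γ).andE1 (J - (A α).L - 1))
        + ∑ α, ∑ γ, kd (A α) false true * (h0 (α, γ) * (E γ).andE2 (J - (A α).L - 1))) := by
    rw [Fintype.sum_prod_type]
    simp only [← Finset.sum_add_distrib]
    refine Finset.sum_congr rfl fun α _ => Finset.sum_congr rfl fun γ _ => ?_
    obtain ⟨e1, e2⟩ := andE_attP A E α γ J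
    rw [e1, e2]; ring
  rw [hsplit, R]
  refine add_nonneg (add_nonneg (add_nonneg (Finset.sum_nonneg fun α _ => ?_) (Finset.sum_nonneg fun α _ => ?_))
    (Finset.sum_nonneg fun α _ => ?_)) (Finset.sum_nonneg fun K _ => ?_)
  · rw [← Finset.mul_sum]
    exact mul_nonneg (kd_nonneg _ _ _) (f5 _ _ (mono_right m0 α) (mono_right m1 α) (fun γ => n0 _) (fun γ => le _) _)
  · rw [← Finset.mul_sum]
    exact mul_nonneg (kd_nonneg _ _ _) (f4 _ ((mono_right m1 α).add (mono_right m0 α)) (fun γ => add_nonneg (n1 _) (n0 _)) _)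
  · exact f4 _ (((mono_right m0 α).const_mul (kd_nonneg _ _ _)).add ((mono_right m1 α).const_mul (kd_nonneg _ _ _)))
      (fun γ => add_nonneg (mul_nonneg (kd_nonneg _ _ _) (n0 _)) (mul_nonneg (kd_nonneg _ _ _) (n1 _))) _
  · have hm0 := aggW_mono A hU m0 n0 K
    have hm1 := aggW_mono A hU m1 n1 K
    exact f5 _ _ (mono_sec hm0 false) (mono_sec hm1 true) (fun γ => aggW_nonneg A n0 K _)
      (fun γ => (sec_le hm0 γ).trans (aggW_le A le K _)) _

/-- **Fact 2 for `A ∥ 𝓔`.** [folklore] -/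
theorem attP_parE_Mt_nonneg
    (hU : ∀ h : BA → ℝ, Monotone h → (∀ α, 0 ≤ h α) → ∀ K : ℤ,
      0 ≤ ∑ α, h α * ((if (A α).L = K then (1 : ℝ) else 0) * (kd (A α) true false - kd (A α) false true)))
    (f2 : ∀ h0 h1 : Bool × C → ℝ, Monotone h0 → Monotone h1 → (∀ p, 0 ≤ h0 p) → (∀ p, h0 p ≤ h1 p) → ∀ J : ℤ, 0 ≤ Mt (parE E) h0 h1 J)
    (f4 : ∀ h : C → ℝ, Monotone h → (∀ γ, 0 ≤ h γ) → ∀ J : ℤ, 0 ≤ ∑ γ, h γ * (E γ).andCon J)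
    {H0 H1 : Bool × (BA × C) → ℝ} (m0 : Monotone H0) (m1 : Monotone H1) (n0 : ∀ p, 0 ≤ H0 p) (le : ∀ p, H0 p ≤ H1 p) (J : ℤ) :
    0 ≤ Mt (parE (attP A E)) H0 H1 J := by
  let ψ : BA × (Bool × C) ≃ Bool × (BA × C) :=
    { toFun := fun q => (q.2.1, (q.1, q.2.2)), invFun := fun q => (q.2.1, (q.1, q.2.2)), left_inv := fun _ => rfl, right_inv := fun _ => rfl }
  have hψ : Monotone ψ := fun p q hpq => by
    obtain ⟨h1, h23⟩ := Prod.mk_le_mk.1 hpq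
    obtain ⟨h2, h3⟩ := Prod.mk_le_mk.1 h23
    exact Prod.mk_le_mk.2 ⟨h2, Prod.mk_le_mk.2 ⟨h1, h3⟩⟩
  have key := attP_Mt_nonneg A (parE E) hU f2 (fun _ _ m0' m1' n0' le' J' => Mt_par_par_nonneg f2 f4 m0' m1' n0' le' J')
    (fun _ mh nh J' => andCon_par_nonneg f4 mh nh J') (m0.comp hψ) (m1.comp hψ) (fun p => n0 _) (fun p => le _) J
  unfold Mt at key ⊢
  rw [← Equiv.sum_comp ψ]
  refine key.trans_eq (Finset.sum_congr rfl fun q _ => ?_)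
  obtain ⟨α, b, γ⟩ := q
  have he : parE (attP A E) (ψ (α, b, γ)) = attP A (parE E) (α, b, γ) := by
    show (attP A E (α, γ)).par b = attP A (parE E) (α, b, γ)
    simp only [attP, parE, EDat.par, acomb_par]
  simp only [Function.comp_apply, he]

/-- **The five facts pass from `𝓔` to `A ∥ 𝓔`** for every abstract special-free box `A` with Theorem U at every exact level. [folklore] -/
theorem attP_facts
    (hU : ∀ h : BA → ℝ, Monotone h → (∀ α, 0 ≤ h α) → ∀ K : ℤ,
      0 ≤ ∑ α, h α * ((if (A α).L = K then (1 : ℝ) else 0) * (kd (A α) true false - kd (A α) false true)))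
    (h5 : (∀ h0 h1 : C → ℝ, Monotone h0 → Monotone h1 → (∀ γ, 0 ≤ h0 γ) → (∀ γ, h0 γ ≤ h1 γ) → ∀ J : ℤ, 0 ≤ Mt E h0 h1 J)
      ∧ (∀ h0 h1 : Bool × C → ℝ, Monotone h0 → Monotone h1 → (∀ p, 0 ≤ h0 p) → (∀ p, h0 p ≤ h1 p) → ∀ J : ℤ, 0 ≤ Mt (parE E) h0 h1 J)
      ∧ (∀ h : C → ℝ, Monotone h → (∀ γ, 0 ≤ h γ) → ∀ J : ℤ, 0 ≤ ∑ γ, h γ * (E γ).andDel J)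
      ∧ (∀ h : C → ℝ, Monotone h → (∀ γ, 0 ≤ h γ) → ∀ J : ℤ, 0 ≤ ∑ γ, h γ * (E γ).andCon J)
      ∧ (∀ h0 h1 : C → ℝ, Monotone h0 → Monotone h1 → (∀ γ, 0 ≤ h0 γ) → (∀ γ, h0 γ ≤ h1 γ) → ∀ J : ℤ,
          0 ≤ ∑ γ, (h1 γ * (E γ).andE1 J + h0 γ * (E γ).andE2 J))) :
    (∀ h0 h1 : BA × C → ℝ, Monotone h0 → Monotone h1 → (∀ γ, 0 ≤ h0 γ) → (∀ γ, h0 γ ≤ h1 γ) → ∀ J : ℤ, 0 ≤ Mt (attP A E) h0 h1 J)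
      ∧ (∀ h0 h1 : Bool × (BA × C) → ℝ, Monotone h0 → Monotone h1 → (∀ p, 0 ≤ h0 p) → (∀ p, h0 p ≤ h1 p) → ∀ J : ℤ,
        0 ≤ Mt (parE (attP A E)) h0 h1 J)
      ∧ (∀ h : BA × C → ℝ, Monotone h → (∀ γ, 0 ≤ h γ) → ∀ J : ℤ, 0 ≤ ∑ γ, h γ * (attP A E γ).andDel J)
      ∧ (∀ h : BA × C → ℝ, Monotone h → (∀ γ, 0 ≤ h γ) → ∀ J : ℤ, 0 ≤ ∑ γ, h γ * (attP A E γ).andCon J)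
      ∧ (∀ h0 h1 : BA × C → ℝ, Monotone h0 → Monotone h1 → (∀ γ, 0 ≤ h0 γ) → (∀ γ, h0 γ ≤ h1 γ) → ∀ J : ℤ,
          0 ≤ ∑ γ, (h1 γ * (attP A E γ).andE1 J + h0 γ * (attP A E γ).andE2 J)) := by
  obtain ⟨f1, f2, f3, f4, f5⟩ := h5
  exact ⟨fun _ _ m0 m1 n0 le J => attP_Mt_nonneg A E hU f1 f2 f4 m0 m1 n0 le J,
    fun _ _ m0 m1 n0 le J => attP_parE_Mt_nonneg A E hU f2 f4 m0 m1 n0 le J,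
    fun h mh nh J => attP_andDel_nonneg A E hU f3 f4 f5 h mh nh J, fun h mh nh J => attP_andCon_nonneg A E f4 h mh nh J,
    fun h0 h1 m0 m1 n0 le J => attP_andFree_nonneg A E hU f4 f5 h0 h1 m0 m1 n0 le J⟩

end Nonneg

end RootForm

end FK

end Summit.CriticalPhenomena.PercolationContinuityZ3.Theorems

end
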